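import Summits.CriticalPhenomena.PercolationContinuityZ3.Theorems.PercNearOneGluingNoHeavyQuantFarRelayRowSharpness
import HarnessLib

/-!
# QUANT lane R8: the RANK form of the far-relay row is sharp in the rank — two certified witnesses (`2j` relays do not suffice)

builds on p205010 (kernel theorem, internal audit signed; external expert review pending)

Support file (`--supports stmt-CriticalPhenomena-4575`), seat `prim-quant-p1` (gen 3); memo `run/shared/lean/prim/quant/P1-SURPLUS.md` §13.1.
No definitions, no named facts, no sorries; one `native_decide` per witness (computational, as in `…QuantFarRelayRowSharpness`).

FAR (`Quant.FarRelayRow`): `2j < Σ_{a∈A} P(o ↔ a)` and `P(o ↮ a) ≤ t` for ALL `a ∈ A` give `P(N ≤ j) ≤ t`.  The memo's conjecture FAR-RANK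
(census-clean: all graphs `n ≤ 5`, sampled `n = 6, 7`, 1.5·10⁵ instances; all weighted trees tested) asks the cut hypothesis only on SOME
`2j+1` relays: `B ⊆ A`, `|B| = 2j+1`, `P(o ↮ a) ≤ t` on `B` ⟹ `P(N_A ≤ j) ≤ t` ("Condorcet for clusters": the majority event beats the
`(2j+1)`-th most reliable relay).  This file shows the `2j+1` cannot be lowered to `2j`:

* `QuantCensus.farRank_twoJ_witness_one` — `j = 1`: the four-vertex graph `o–a, o–b` of weight `1/2`, `a–c, b–c` of weight `9/10`
  (the `W4` family of P1-SURPLUS §12.1 at `δ = 0`): `Σ_a P(o ↔ a) = 841/400 > 2`, `P(o ↮ a) = P(o ↮ b) = 119/400`, but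
  `P(N ≤ 1) = 3/10 > 119/400`.  Equivalently 'Z-mid' (`Σ q > 2 ⟹ P(N ≥ 2) ≥ q_mid`) is false — previously a paper remark (§12.1 (ii)), now kernel.
* `QuantCensus.farRank_twoJ_witness_two` — `j = 2`: the seven-vertex tree `o–a₁ (9/10), o–a₂ (4/5), o–a₃ (9/10), a₂–a₄ (1), a₂–a₅ (3/4), a₄–a₆ (9/10)`,
  `A = {a₁,…,a₆}`: `Σ = 118/25 > 4`, the four most reliable relays have `P(o ↮ a) ≤ 1/5`, but `P(N ≤ 2) = 1001/5000 > 1/5`.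
[cite: KozmaNitzan2024, Lemma 2 (p. 6), Conjecture 3 (p. 15)]
-/

namespace Summit.CriticalPhenomena.PercolationContinuityZ3.Theorems

open MeasureTheory
open Literature.Probability.LatticeModels Literature.Probability.Percolation
open Summit.CriticalPhenomena.PercolationContinuityZ3.Theorems.AdditiveGluing.Negative.Cert

namespace QuantCensus

/-! ### Witness 1 (`j = 1`): `W4` at `δ = 0` -/

/-- The `j = 1` witness weight list has no repeated pair. [this work] -/
theorem rankOne_wlist_nodup :
    (wPairs ([((0 : Fin 4), (1 : Fin 4), (1/2 : ℚ)), (0, 2, 1/2), (1, 3, 9/10), (2, 3, 9/10)] : List (Fin 4 × Fin 4 × ℚ))).Nodup := by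
  decide

/-- The `j = 1` witness weights lie in `[0, 1]`. [this work] -/
theorem rankOne_wlist_unit :
    ∀ e ∈ ([((0 : Fin 4), (1 : Fin 4), (1/2 : ℚ)), (0, 2, 1/2), (1, 3, 9/10), (2, 3, 9/10)] : List (Fin 4 × Fin 4 × ℚ)),
      0 ≤ e.2.2 ∧ e.2.2 ≤ 1 := by
  intro e he
  simp only [List.mem_cons, List.mem_nil_iff, or_false] at he
  rcases he with rfl | rfl | rfl | rfl <;> norm_num

/-- The three rational facts of the `j = 1` witness (one `native_decide` over `2⁴` configurations): (i) `2 < Σ_{a∈{1,2,3}} wConn 0 a`,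
(ii) `wNotConn 0 a ≤ 119/400` for `a ∈ {1,2}`, (iii) `3/10 ≤` the weighted count of `#{a ∈ {1,2,3} : 0 ↔ a} ≤ 1`. [this work] -/
theorem rankOne_check :
    ((decide ((2 : ℚ) < (List.map (fun x => wConn (wtabs 4 ([((0 : Fin 4), (1 : Fin 4), (1/2 : ℚ)), (0, 2, 1/2), (1, 3, 9/10),
        (2, 3, 9/10)] : List (Fin 4 × Fin 4 × ℚ))) (0 : Fin 4) x) ([1, 2, 3] : List (Fin 4))).sum) &&
      List.all ([1, 2] : List (Fin 4)) (fun a => decide (wNotConn (wtabs 4 ([((0 : Fin 4), (1 : Fin 4), (1/2 : ℚ)), (0, 2, 1/2),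
        (1, 3, 9/10), (2, 3, 9/10)] : List (Fin 4 × Fin 4 × ℚ))) (0 : Fin 4) a ≤ (119/400 : ℚ)))) &&
      decide ((3/10 : ℚ) ≤ (((wtabs 4 ([((0 : Fin 4), (1 : Fin 4), (1/2 : ℚ)), (0, 2, 1/2), (1, 3, 9/10), (2, 3, 9/10)] :
        List (Fin 4 × Fin 4 × ℚ))).map fun t =>
          if decide ((Finset.filter (fun x : Fin 4 => (t.1.getD (0 : Fin 4) 0).testBit x = true)
            (List.toFinset ([1, 2, 3] : List (Fin 4)))).card ≤ 1) then t.2 else 0).sum))) = true := by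
  native_decide

open Classical in
/-- **The rank form of FAR fails with `2j` relays, `j = 1`**: it is NOT true that `2 < Σ_{a∈A} P(o ↔ a)` together with `P(o ↮ a) ≤ t` on a
two-element `B ⊆ A` forces `P(N_A ≤ 1) ≤ t`.  Witness: `o–a, o–b` weight `1/2`, `a–c, b–c` weight `9/10`, `A = {a,b,c}`, `B = {a,b}`, `t = 119/400`:
`Σ = 841/400`, `P(N ≤ 1) = 3/10 > t` (so `P(N ≥ 2) = 7/10 < q_(2) = 281/400`: 'Z-mid' is false). [this work] -/
theorem farRank_twoJ_witness_one :
    ¬ ∀ (n : ℕ) (w : Sym2 (Fin n) → unitInterval) (A B : Finset (Fin n)) (o : Fin n) (j : ℕ) (t : ℝ),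
      B ⊆ A → B.card = 2 * j →
      (2 * j : ℝ) < ∑ a ∈ A, (prodBernoulli w).real (openConn o a) →
      (∀ a ∈ B, (prodBernoulli w).real (openConn o a)ᶜ ≤ t) →
      (prodBernoulli w).real {ω : BondConfig (Fin n) | (A.filter fun a => ω ∈ openConn o a).card ≤ j} ≤ t := by
  intro h
  set l : List (Fin 4 × Fin 4 × ℚ) := [((0 : Fin 4), (1 : Fin 4), (1/2 : ℚ)), (0, 2, 1/2), (1, 3, 9/10), (2, 3, 9/10)] with hl
  have hnd : (wPairs l).Nodup := rankOne_wlist_nodup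
  have hq : ∀ e ∈ l, 0 ≤ e.2.2 ∧ e.2.2 ≤ 1 := rankOne_wlist_unit
  set A : Finset (Fin 4) := List.toFinset ([1, 2, 3] : List (Fin 4)) with hA
  set B : Finset (Fin 4) := List.toFinset ([1, 2] : List (Fin 4)) with hB
  have hchk := rankOne_check
  rw [Bool.and_eq_true, Bool.and_eq_true] at hchk
  obtain ⟨⟨h1, h2⟩, h3⟩ := hchk
  have hAnd : (([1, 2, 3] : List (Fin 4))).Nodup := by decide
  have hBA : B ⊆ A := by rw [hA, hB]; decide
  have hBcard : B.card = 2 * 1 := by rw [hB]; decide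
  have hEN : (2 * (1 : ℕ) : ℝ) < ∑ a ∈ A, (prodBernoulli (wOfList l)).real (openConn (0 : Fin 4) a) := by
    have hsum : ∑ a ∈ A, (prodBernoulli (wOfList l)).real (openConn (0 : Fin 4) a) =
        ((∑ a ∈ A, wConn (wtabs 4 l) (0 : Fin 4) a : ℚ) : ℝ) := by
      rw [Rat.cast_sum]
      exact Finset.sum_congr rfl fun x _ => real_openConn_eq_wConn hnd hq 0 x
    rw [hsum]
    have h1' : (2 : ℚ) < ∑ a ∈ A, wConn (wtabs 4 l) (0 : Fin 4) a := by
      rw [hA, List.sum_toFinset _ hAnd]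
      exact of_decide_eq_true h1
    have : (((2 : ℚ)) : ℝ) < ((∑ a ∈ A, wConn (wtabs 4 l) (0 : Fin 4) a : ℚ) : ℝ) := by exact_mod_cast h1'
    norm_num at this ⊢
    exact this
  have hcut : ∀ a ∈ B, (prodBernoulli (wOfList l)).real (openConn (0 : Fin 4) a)ᶜ ≤ (((119/400 : ℚ)) : ℝ) := by
    intro a ha
    rw [real_compl_openConn_eq_wNotConn hnd hq 0 a]
    have ha' : a ∈ ([1, 2] : List (Fin 4)) := by rw [hB, List.mem_toFinset] at ha; exact ha
    exact_mod_cast of_decide_eq_true (List.all_eq_true.1 h2 a ha')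
  have hlow : (((3/10 : ℚ)) : ℝ) ≤ (prodBernoulli (wOfList l)).real
      {ω | (Finset.filter (fun x => ω ∈ openConn (0 : Fin 4) x) A).card ≤ 1} :=
    QuantGluing.real_levelCount_ge hnd hq 0 A 1 (of_decide_eq_true h3)
  have hinst := h 4 (wOfList l) A B 0 1 (((119/400 : ℚ)) : ℝ) hBA hBcard hEN hcut
  have hlt : (((119/400 : ℚ)) : ℝ) < (((3/10 : ℚ)) : ℝ) := by norm_num
  linarith

/-! ### Witness 2 (`j = 2`): a seven-vertex tree -/

/-- The `j = 2` witness weight list has no repeated pair. [this work] -/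
theorem rankTwo_wlist_nodup :
    (wPairs ([((0 : Fin 7), (1 : Fin 7), (9/10 : ℚ)), (0, 2, 4/5), (0, 3, 9/10), (2, 4, 1), (2, 5, 3/4), (4, 6, 9/10)] :
      List (Fin 7 × Fin 7 × ℚ))).Nodup := by
  decide

/-- The `j = 2` witness weights lie in `[0, 1]`. [this work] -/
theorem rankTwo_wlist_unit :
    ∀ e ∈ ([((0 : Fin 7), (1 : Fin 7), (9/10 : ℚ)), (0, 2, 4/5), (0, 3, 9/10), (2, 4, 1), (2, 5, 3/4), (4, 6, 9/10)] :
      List (Fin 7 × Fin 7 × ℚ)), 0 ≤ e.2.2 ∧ e.2.2 ≤ 1 := by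
  intro e he
  simp only [List.mem_cons, List.mem_nil_iff, or_false] at he
  rcases he with rfl | rfl | rfl | rfl | rfl | rfl <;> norm_num

/-- The three rational facts of the `j = 2` witness (one `native_decide` over `2⁶` configurations): (i) `4 < Σ_{a∈{1,…,6}} wConn 0 a`
(it is `118/25`), (ii) `wNotConn 0 a ≤ 1/5` for `a ∈ {1,2,3,4}`, (iii) `1001/5000 ≤` the weighted count of `#{a : 0 ↔ a} ≤ 2`. [this work] -/
theorem rankTwo_check :
    ((decide ((4 : ℚ) < (List.map (fun x => wConn (wtabs 7 ([((0 : Fin 7), (1 : Fin 7), (9/10 : ℚ)), (0, 2, 4/5), (0, 3, 9/10),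
        (2, 4, 1), (2, 5, 3/4), (4, 6, 9/10)] : List (Fin 7 × Fin 7 × ℚ))) (0 : Fin 7) x) ([1, 2, 3, 4, 5, 6] : List (Fin 7))).sum) &&
      List.all ([1, 2, 3, 4] : List (Fin 7)) (fun a => decide (wNotConn (wtabs 7 ([((0 : Fin 7), (1 : Fin 7), (9/10 : ℚ)), (0, 2, 4/5),
        (0, 3, 9/10), (2, 4, 1), (2, 5, 3/4), (4, 6, 9/10)] : List (Fin 7 × Fin 7 × ℚ))) (0 : Fin 7) a ≤ (1/5 : ℚ)))) &&
      decide ((1001/5000 : ℚ) ≤ (((wtabs 7 ([((0 : Fin 7), (1 : Fin 7), (9/10 : ℚ)), (0, 2, 4/5), (0, 3, 9/10), (2, 4, 1), (2, 5, 3/4),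
        (4, 6, 9/10)] : List (Fin 7 × Fin 7 × ℚ))).map fun t =>
          if decide ((Finset.filter (fun x : Fin 7 => (t.1.getD (0 : Fin 7) 0).testBit x = true)
            (List.toFinset ([1, 2, 3, 4, 5, 6] : List (Fin 7)))).card ≤ 2) then t.2 else 0).sum))) = true := by
  native_decide

open Classical in
/-- **The rank form of FAR fails with `2j` relays, `j = 2`**: on the tree `o–a₁ (9/10), o–a₂ (4/5), o–a₃ (9/10), a₂–a₄ (1), a₂–a₅ (3/4),
a₄–a₆ (9/10)` with `A = {a₁,…,a₆}` one has `Σ_a P(o ↔ a) = 118/25 > 4` and `P(o ↮ a) ≤ 1/5` on `B = {a₁,a₂,a₃,a₄}` (`|B| = 4 = 2j`), yet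
`P(N ≤ 2) = 1001/5000 > 1/5` (while `P(N ≥ 3) = 3999/5000 ≥ q_(5) = 18/25`, as FAR-RANK predicts). [this work] -/
theorem farRank_twoJ_witness_two :
    ¬ ∀ (n : ℕ) (w : Sym2 (Fin n) → unitInterval) (A B : Finset (Fin n)) (o : Fin n) (j : ℕ) (t : ℝ),
      B ⊆ A → B.card = 2 * j →
      (2 * j : ℝ) < ∑ a ∈ A, (prodBernoulli w).real (openConn o a) →
      (∀ a ∈ B, (prodBernoulli w).real (openConn o a)ᶜ ≤ t) →
      (prodBernoulli w).real {ω : BondConfig (Fin n) | (A.filter fun a => ω ∈ openConn o a).card ≤ j} ≤ t := by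
  intro h
  set l : List (Fin 7 × Fin 7 × ℚ) := [((0 : Fin 7), (1 : Fin 7), (9/10 : ℚ)), (0, 2, 4/5), (0, 3, 9/10), (2, 4, 1), (2, 5, 3/4),
    (4, 6, 9/10)] with hl
  have hnd : (wPairs l).Nodup := rankTwo_wlist_nodup
  have hq : ∀ e ∈ l, 0 ≤ e.2.2 ∧ e.2.2 ≤ 1 := rankTwo_wlist_unit
  set A : Finset (Fin 7) := List.toFinset ([1, 2, 3, 4, 5, 6] : List (Fin 7)) with hA
  set B : Finset (Fin 7) := List.toFinset ([1, 2, 3, 4] : List (Fin 7)) with hB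
  have hchk := rankTwo_check
  rw [Bool.and_eq_true, Bool.and_eq_true] at hchk
  obtain ⟨⟨h1, h2⟩, h3⟩ := hchk
  have hAnd : (([1, 2, 3, 4, 5, 6] : List (Fin 7))).Nodup := by decide
  have hBA : B ⊆ A := by rw [hA, hB]; decide
  have hBcard : B.card = 2 * 2 := by rw [hB]; decide
  have hEN : (2 * (2 : ℕ) : ℝ) < ∑ a ∈ A, (prodBernoulli (wOfList l)).real (openConn (0 : Fin 7) a) := by
    have hsum : ∑ a ∈ A, (prodBernoulli (wOfList l)).real (openConn (0 : Fin 7) a) =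
        ((∑ a ∈ A, wConn (wtabs 7 l) (0 : Fin 7) a : ℚ) : ℝ) := by
      rw [Rat.cast_sum]
      exact Finset.sum_congr rfl fun x _ => real_openConn_eq_wConn hnd hq 0 x
    rw [hsum]
    have h1' : (4 : ℚ) < ∑ a ∈ A, wConn (wtabs 7 l) (0 : Fin 7) a := by
      rw [hA, List.sum_toFinset _ hAnd]
      exact of_decide_eq_true h1
    have : (((4 : ℚ)) : ℝ) < ((∑ a ∈ A, wConn (wtabs 7 l) (0 : Fin 7) a : ℚ) : ℝ) := by exact_mod_cast h1'
    norm_num at this ⊢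
    exact this
  have hcut : ∀ a ∈ B, (prodBernoulli (wOfList l)).real (openConn (0 : Fin 7) a)ᶜ ≤ (((1/5 : ℚ)) : ℝ) := by
    intro a ha
    rw [real_compl_openConn_eq_wNotConn hnd hq 0 a]
    have ha' : a ∈ ([1, 2, 3, 4] : List (Fin 7)) := by rw [hB, List.mem_toFinset] at ha; exact ha
    exact_mod_cast of_decide_eq_true (List.all_eq_true.1 h2 a ha')
  have hlow : (((1001/5000 : ℚ)) : ℝ) ≤ (prodBernoulli (wOfList l)).real
      {ω | (Finset.filter (fun x => ω ∈ openConn (0 : Fin 7) x) A).card ≤ 2} :=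
    QuantGluing.real_levelCount_ge hnd hq 0 A 2 (of_decide_eq_true h3)
  have hinst := h 7 (wOfList l) A B 0 2 (((1/5 : ℚ)) : ℝ) hBA hBcard hEN hcut
  have hlt : (((1/5 : ℚ)) : ℝ) < (((1001/5000 : ℚ)) : ℝ) := by norm_num
  linarith

end QuantCensus

end Summit.CriticalPhenomena.PercolationContinuityZ3.Theorems
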